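import Mathlib
import Literature.Analysis.FluidPDE.TaoAveragedAngleSynthesis
import Summits.NavierStokesRegularity.NavierStokesRegularity.Theorems.ThreadingFluxHorizonTowerProfileFormulas
import HarnessLib

/-!
# Crux `PoloidalLiouville` (stmt-NavierStokesRegularity-1222, wall W1), crux idea «horizon-threading-tower» (ns-idea-15):
# THE ORDER-TWO HORIZON LAW OF A SINGLE-DEGREE HORIZON PROFILE IN CLOSED FORM (all degrees `l`) — part 1: frame calculus and
# the closed forms of `U_H`, `Ω = curl U_H` and the Lamb vector `λ = U_H × Ω`

Support file (Theorems-side tooling; seat ns-wall-eng-4 g2, cell ns-wall-extremal, item «HT1 (ii) IDENTIFICATION»;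
`--supports stmt-NavierStokesRegularity-1222 --as helper`).  For a smooth, degree-`l` homogeneous (`l ≥ 1`), harmonic
`H : ℝ³ → ℝ` and the horizon profile `U = horizonProfile l H 0 = curl curl (‖y‖^{1−l} H(y) y)` of
`Theorems/ThreadingFluxHorizonTowerDefs.lean`, write `q = ‖z‖²`, `a = (1 − l)/2`, `κ = (l − 1)(l + 2)`, `W = ∇H × z`,
`G = ‖∇H‖²`, `V = ∇G × z`.  Off the origin:

* `HorizonTower.horizonProfile_eq_closedForm` — `U(z) = 2 qᵃ ∇H(z) + l(l−1) H(z) q^{a−1} z`;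
* `HorizonTower.curl_horizonProfile_eq` — `Ω(z) = curl U (z) = κ q^{a−1} W(z)`;
* `HorizonTower.lamb_horizonProfile_eq` — `U × Ω = κ l(l+1) H q^{2a−1} ∇H − κ (2 G q^{2a−1} + l²(l−1) H² q^{2a−2}) z`;

together with the toolkit they need (`OrderTwo.*`: cross-product algebra in coordinates, `curl (f ∇θ) = ∇f × ∇θ`, gradients of
the coefficient functions, the bookkeeping `rpow_canon` of the powers of `q`) and the Euler identities for `H` and `G`
(`inner_gradient_self_of_homogeneous_nat`, `gradient_smul_of_homogeneous_nat`, `inner_gradient_gradNormSq_self`).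
Part 2 (`ThreadingFluxHorizonTowerL2ClosedFormLaw.lean`) computes `curl λ`, contracts the two order-two terms against `z` and
proves `𝔏₂[U_H](x) = −4 (l−1)(l+2) · det(∇H, ∇G, x) / ‖x‖^{3(l−1)}` (DATUM B-ht2 of ns-wall-eng-7 g3: engine-exact for `l ≤ 7`,
pen-and-paper for all `l`; there a kernel theorem for all `l`), whence the l = 3 IDENTIFICATION `‖x‖⁶·𝔏₂[U_{H_a}] = horizonNumerator a x`.

HONEST LABEL: pure vector calculus about the typed objects of one crux idea (information-grade for W1/W2, movement 0);
`PoloidalLiouville` (1222), `UnthreadedRigidity` (27585) and NS regularity remain OPEN and untouched.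
[cite: MajdaBertozziCUP2002, §1.1 (vector identities)]
-/

-- the summit and its single problem share the name (D-0017 nested layout)
set_option linter.dupNamespace false

noncomputable section

open Set Function Filter Topology
open scoped Topology RealInnerProductSpace
open Literature.Analysis.FluidPDE

namespace Summit.NavierStokesRegularity.NavierStokesRegularity.Theorems.PoloidalLiouville.HorizonTower

open PoloidalField

/-! ### Frame algebra on `ℝ³` (coordinates)

Bilinearity, BAC − CAB and the vanishing triple products are the tree's `Tao2016.cross_add_left/right`,
`Tao2016.cross_smul_left/right`, `Tao2016.cross_cross_eq_smul_sub`, `Tao2016.cross_self_eq_zero`,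
`Tao2016.inner_self_cross_left/right` (`Literature/Analysis/FluidPDE/TaoAveragedNondegeneracy.lean`) and `cross_swap`. -/

namespace OrderTwo

/-- Cyclicity of the scalar triple product: `⟪a, b × c⟫ = ⟪b, c × a⟫`. [folklore] -/
theorem inner_cross_cyclic (a b c : E3) : ⟪a, cross b c⟫ = ⟪b, cross c a⟫ := by
  simp only [cross, PiLp.inner_apply, RCLike.inner_apply, conj_trivial, Fin.sum_univ_three, cross_apply,
    Matrix.cons_val_zero, Matrix.cons_val_one, Matrix.cons_val_two, Matrix.head_cons, Matrix.tail_cons]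
  ring

/-! ### Local calculus: `curl (f ∇θ) = ∇f × ∇θ`, gradients of the coefficient functions -/

/-- `∇θ` is differentiable at `x` for `θ` of class `C²` at `x`. [folklore] -/
theorem differentiableAt_gradient {θ : E3 → ℝ} {x : E3} (hθ : ContDiffAt ℝ 2 θ x) :
    DifferentiableAt ℝ (gradient θ) x := by
  have hD : DifferentiableAt ℝ (fderiv ℝ θ) x := (hθ.fderiv_right (m := 1) (by norm_num)).differentiableAt (by simp)
  exact ((InnerProductSpace.toDual ℝ E3).symm.differentiableAt).comp x hD

/-- `∇θ` is `Cⁿ` for `θ` of class `C^{n+1}`. [folklore] -/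
theorem contDiff_gradient {θ : E3 → ℝ} {n : ℕ∞} (hθ : ContDiff ℝ (n + 1) θ) : ContDiff ℝ n (gradient θ) :=
  (InnerProductSpace.toDual ℝ E3).symm.contDiff.comp (hθ.fderiv_right (m := n) le_rfl)

/-- **`curl (f ∇θ)(x) = ∇f(x) × ∇θ(x)`** for `f` differentiable at `x` and `θ` of class `C²` at `x`
(`curl (f F) = f curl F + ∇f × F`, `curl ∇θ = 0`). [cite: MajdaBertozziCUP2002, §1.1 (vector identities)] -/
theorem curl_smul_gradient {f θ : E3 → ℝ} {x : E3} (hf : DifferentiableAt ℝ f x) (hθ : ContDiffAt ℝ 2 θ x) :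
    curl (fun z => f z • gradient θ z) x = cross (gradient f x) (gradient θ x) := by
  rw [curl_smul hf (differentiableAt_gradient hθ), curl_gradient_eq_zero_of_contDiffAt hθ, smul_zero, zero_add,
    fderiv_eq_innerSL_gradient, curlCLM_smulRight_innerSL]

/-- `∇(c f)(x) = c ∇f(x)`. [folklore] -/
theorem gradient_const_mul' {f : E3 → ℝ} {x : E3} (hf : DifferentiableAt ℝ f x) (c : ℝ) :
    gradient (fun z => c * f z) x = c • gradient f x := by
  apply ext_inner_right ℝ
  intro v
  rw [real_inner_smul_left, Literature.Analysis.FluidPDE.inner_gradient_left,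
    Literature.Analysis.FluidPDE.inner_gradient_left, fderiv_const_mul hf]
  simp

/-- `∇(f²)(x) = 2 f(x) ∇f(x)`. [folklore] -/
theorem gradient_sq {f : E3 → ℝ} {x : E3} (hf : DifferentiableAt ℝ f x) :
    gradient (fun z => f z ^ 2) x = (2 * f x) • gradient f x := by
  have h := gradient_mul_apply hf hf
  simp only [← pow_two] at h
  rw [h, ← add_smul]
  congr 1
  ring

/-- `∇(‖·‖²)ᵇ (x) = 2b (‖x‖²)^{b−1} x` off the origin. [folklore] -/
theorem gradient_rpow_normSq {x : E3} (hx : x ≠ 0) (b : ℝ) :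
    gradient (fun z : E3 => (‖z‖ ^ 2) ^ b) x = (2 * (b * (‖x‖ ^ 2) ^ (b - 1))) • x :=
  gradient_comp_norm_sq (hasDerivAt_rpow_normSq hx b)

/-- `z ↦ (‖z‖²)ᵇ` is differentiable off the origin. [folklore] -/
theorem differentiableAt_rpow_normSq {x : E3} (hx : x ≠ 0) (b : ℝ) :
    DifferentiableAt ℝ (fun z : E3 => (‖z‖ ^ 2) ^ b) x :=
  (contDiffAt_rpow_normSq hx b (n := 1)).differentiableAt (by simp)

end OrderTwo

open OrderTwo

/-! ### Euler identities for `H` and `G = ‖∇H‖²` -/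

section Euler

variable {l : ℕ} {H : E3 → ℝ}

/-- Euler: `⟪∇H(z), z⟫ = l H(z)` for `H` homogeneous of degree `l`, differentiable at `z`. [folklore] -/
theorem inner_gradient_self_of_homogeneous_nat {z : E3} (hH : DifferentiableAt ℝ H z)
    (hhom : ∀ (c : ℝ) (y : E3), H (c • y) = c ^ l * H y) : ⟪gradient H z, z⟫ = (l : ℝ) * H z := by
  rw [Literature.Analysis.FluidPDE.inner_gradient_left, fderiv_apply_self_of_homogeneous_nat hH hhom]

/-- The gradient of a degree-`l` homogeneous function (`l ≥ 1`) is homogeneous of degree `l − 1`: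
`∇H(c y) = c^{l−1} ∇H(y)` for `c ≠ 0`. [folklore] -/
theorem gradient_smul_of_homogeneous_nat (hl : 1 ≤ l) (hHd : ∀ z, DifferentiableAt ℝ H z)
    (hhom : ∀ (c : ℝ) (y : E3), H (c • y) = c ^ l * H y) {c : ℝ} (hc : c ≠ 0) (y : E3) :
    gradient H (c • y) = c ^ (l - 1) • gradient H y := by
  have hL : HasFDerivAt (fun z : E3 => c • z) (c • ContinuousLinearMap.id ℝ E3) y := (hasFDerivAt_id y).const_smul c
  have h1 : HasFDerivAt (fun z => H (c • z)) ((fderiv ℝ H (c • y)).comp (c • ContinuousLinearMap.id ℝ E3)) y :=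
    (hHd (c • y)).hasFDerivAt.comp y hL
  have h2 : HasFDerivAt (fun z => H (c • z)) (c ^ l • fderiv ℝ H y) y := by
    have : (fun z => H (c • z)) = fun z => c ^ l * H z := funext fun z => hhom c z
    rw [this]
    exact (hHd y).hasFDerivAt.const_mul (c ^ l)
  have h3 : (fderiv ℝ H (c • y)).comp (c • ContinuousLinearMap.id ℝ E3) = c ^ l • fderiv ℝ H y := h1.unique h2
  have h4 : c • fderiv ℝ H (c • y) = c • (c ^ (l - 1) • fderiv ℝ H y) := by
    rw [smul_smul, ← pow_succ', Nat.sub_add_cancel hl, ← h3]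
    ext v
    simp
  have h5 : fderiv ℝ H (c • y) = c ^ (l - 1) • fderiv ℝ H y := smul_right_injective _ hc h4
  apply ext_inner_right ℝ
  intro v
  rw [real_inner_smul_left, Literature.Analysis.FluidPDE.inner_gradient_left,
    Literature.Analysis.FluidPDE.inner_gradient_left, h5]
  simp

/-- `G = ‖∇H‖²` is homogeneous of degree `2(l−1)` along positive dilations:
`G(c y) = c^{2(l−1)} G(y)` for `c > 0`. [folklore] -/
theorem gradNormSq_smul (hl : 1 ≤ l) (hHd : ∀ z, DifferentiableAt ℝ H z)
    (hhom : ∀ (c : ℝ) (y : E3), H (c • y) = c ^ l * H y) {c : ℝ} (hc : 0 < c) (y : E3) :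
    ‖gradient H (c • y)‖ ^ 2 = c ^ (2 * (l - 1)) * ‖gradient H y‖ ^ 2 := by
  rw [gradient_smul_of_homogeneous_nat hl hHd hhom hc.ne' y, norm_smul, mul_pow, Real.norm_of_nonneg (pow_nonneg hc.le _),
    ← pow_mul, mul_comm (l - 1)]

/-- Euler for `G = ‖∇H‖²`: `⟪∇G(z), z⟫ = 2(l−1) G(z)` (`H` of class `C²`, homogeneous of degree `l ≥ 1`). [folklore] -/
theorem inner_gradient_gradNormSq_self (hl : 1 ≤ l) (hH : ContDiff ℝ 2 H)
    (hhom : ∀ (c : ℝ) (y : E3), H (c • y) = c ^ l * H y) (z : E3) :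
    ⟪gradient (fun w : E3 => ‖gradient H w‖ ^ 2) z, z⟫ = (2 * ((l : ℝ) - 1)) * ‖gradient H z‖ ^ 2 := by
  have hHd : ∀ w, DifferentiableAt ℝ H w := fun w => (hH.differentiable (by norm_num)).differentiableAt
  have hGd : DifferentiableAt ℝ (fun w : E3 => ‖gradient H w‖ ^ 2) z :=
    (differentiableAt_gradient hH.contDiffAt).norm_sq ℝ
  have hev : ∀ᶠ c in 𝓝 (1 : ℝ), (fun w : E3 => ‖gradient H w‖ ^ 2) (c • z)
      = (fun c : ℝ => c ^ (2 * (l - 1))) c • (fun w : E3 => ‖gradient H w‖ ^ 2) z := by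
    filter_upwards [Ioi_mem_nhds (zero_lt_one' ℝ)] with c hc
    simp only [smul_eq_mul]
    exact gradNormSq_smul hl hHd hhom hc z
  have ha : HasDerivAt (fun c : ℝ => c ^ (2 * (l - 1))) ((2 * (l - 1) : ℕ) : ℝ) 1 := by
    simpa using hasDerivAt_pow (2 * (l - 1)) (1 : ℝ)
  have h := fderiv_apply_self_of_homogeneous (a := fun c : ℝ => c ^ (2 * (l - 1))) hGd ha hev
  rw [Literature.Analysis.FluidPDE.inner_gradient_left, h, smul_eq_mul]
  congr 1
  push_cast [Nat.cast_sub hl]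
  ring

end Euler

/-! ### Power bookkeeping: every `q`-power in terms of `s = q^{a−1}` and `q` -/

namespace OrderTwo

/-- For `q > 0`: `qᵃ = q^{a−1} q`, `q^{2a−1} = (q^{a−1})² q`, `q^{2a−2} = (q^{a−1})²`, `q^{3a−1} = (q^{a−1})³ q²`,
`q^{3a−2} = (q^{a−1})³ q`, `q^{3a−3} = (q^{a−1})³`. [folklore] -/
theorem rpow_canon {q : ℝ} (hq : 0 < q) (a : ℝ) :
    q ^ a = q ^ (a - 1) * q ∧ q ^ (2 * a - 1) = (q ^ (a - 1)) ^ 2 * q ∧ q ^ (2 * a - 2) = (q ^ (a - 1)) ^ 2 ∧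
    q ^ (3 * a - 1) = (q ^ (a - 1)) ^ 3 * q ^ 2 ∧ q ^ (3 * a - 2) = (q ^ (a - 1)) ^ 3 * q ∧
    q ^ (3 * a - 3) = (q ^ (a - 1)) ^ 3 := by
  have h2 : (q ^ (a - 1)) ^ 2 = q ^ (2 * a - 2) := by
    rw [← Real.rpow_mul_natCast hq.le]; congr 1; push_cast; ring
  have h3 : (q ^ (a - 1)) ^ 3 = q ^ (3 * a - 3) := by
    rw [← Real.rpow_mul_natCast hq.le]; congr 1; push_cast; ring
  refine ⟨?_, ?_, h2.symm, ?_, ?_, h3.symm⟩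
  · rw [← Real.rpow_add_one hq.ne']; congr 1; ring
  · rw [h2, ← Real.rpow_add_one hq.ne']; congr 1; ring
  · rw [h3, ← Real.rpow_natCast q 2, ← Real.rpow_add hq]; congr 1; push_cast; ring
  · rw [h3, ← Real.rpow_add_one hq.ne']; congr 1; ring

end OrderTwo

/-! ### Closed forms of `U_H` and `Ω = curl U_H` -/

section ClosedForms

variable {l : ℕ} {H : E3 → ℝ}

/-- **Closed form of the horizon profile off the origin**: `U(z) = 2 qᵃ ∇H(z) + l(l−1) q^{a−1} H(z) z`, `q = ‖z‖²`,
`a = (1−l)/2` (`H` smooth, `l`-homogeneous with `l ≥ 1`, harmonic).  From ARM A's normal form `U = 2∇φ − (div∇φ) z`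
(`horizonProfile_eq_normalForm`) and the explicit `∇φ`, `div ∇φ` (`gradient_mul_rpow_normSq`, `divergence_gradient_mul_rpow_normSq`).
[cite: MajdaBertozziCUP2002, §1.1 (vector identities)] -/
theorem horizonProfile_eq_closedForm (hl : 1 ≤ l) (hH : ContDiff ℝ (⊤ : ℕ∞) H)
    (hhom : ∀ (c : ℝ) (y : E3), H (c • y) = c ^ l * H y) (hharm : ∀ y, Laplacian.laplacian H y = 0)
    {z : E3} (hz : z ≠ 0) :
    horizonProfile l H 0 z
      = (2 * (‖z‖ ^ 2) ^ (((1 : ℝ) - l) / 2)) • gradient H z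
        + ((l : ℝ) * (l - 1) * ((‖z‖ ^ 2) ^ (((1 : ℝ) - l) / 2 - 1) * H z)) • z := by
  rw [horizonProfile_eq_normalForm hl hH hhom hz]
  set a : ℝ := ((1 : ℝ) - l) / 2 with ha
  set φ : E3 → ℝ := fun w => ‖w‖ ^ ((1 : ℤ) - l) * H w with hφ
  have hHd : ∀ w, DifferentiableAt ℝ H w := fun w => (hH.differentiable (by simp)).differentiableAt
  have hopen : ∀ᶠ w in 𝓝 z, w ≠ (0 : E3) := isOpen_compl_singleton.mem_nhds hz
  have hφev : φ =ᶠ[𝓝 z] fun w => H w * (‖w‖ ^ 2) ^ a := by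
    filter_upwards [hopen] with w hw using potential_eq_rpow hw
  have hgradev : gradient φ =ᶠ[𝓝 z] gradient (fun w : E3 => H w * (‖w‖ ^ 2) ^ a) := by
    filter_upwards [hφev.eventually_nhds] with w hw
    unfold gradient; rw [Filter.EventuallyEq.fderiv_eq hw]
  have hgrad : gradient φ z = ((‖z‖ ^ 2) ^ a) • gradient H z + (2 * (a * (‖z‖ ^ 2) ^ (a - 1)) * H z) • z := by
    rw [hgradev.self_of_nhds]; exact gradient_mul_rpow_normSq hz (hHd z) a
  have hψ : VectorCalculus.divergence (gradient φ) z = a * (4 * l + 4 * a + 2) * (‖z‖ ^ 2) ^ (a - 1) * H z := by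
    rw [show VectorCalculus.divergence (gradient φ) z
        = VectorCalculus.divergence (gradient (fun w : E3 => H w * (‖w‖ ^ 2) ^ a)) z by
      simp only [VectorCalculus.divergence, hgradev.fderiv_eq]]
    exact divergence_gradient_mul_rpow_normSq hz hH hhom hharm a
  rw [hgrad, hψ]
  have key : (l : ℝ) * (l - 1) * ((‖z‖ ^ 2) ^ (a - 1) * H z)
      = 2 * (2 * (a * (‖z‖ ^ 2) ^ (a - 1)) * H z) - a * (4 * l + 4 * a + 2) * (‖z‖ ^ 2) ^ (a - 1) * H z := by
    rw [ha]; ring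
  rw [key]
  module

/-- **`Ω = curl U_H = κ q^{a−1} ∇H × z` off the origin**, `κ = (l−1)(l+2)` (the horizon profile's vorticity is toroidal).
[cite: MajdaBertozziCUP2002, §1.1 (vector identities)] -/
theorem curl_horizonProfile_eq (hl : 1 ≤ l) (hH : ContDiff ℝ (⊤ : ℕ∞) H)
    (hhom : ∀ (c : ℝ) (y : E3), H (c • y) = c ^ l * H y) (hharm : ∀ y, Laplacian.laplacian H y = 0)
    {z : E3} (hz : z ≠ 0) :
    curl (horizonProfile l H 0) z = ((((l : ℝ) - 1) * (l + 2)) * (‖z‖ ^ 2) ^ (((1 : ℝ) - l) / 2 - 1)) • cross (gradient H z) z := by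
  set a : ℝ := ((1 : ℝ) - l) / 2 with ha
  have hHd : ∀ w, DifferentiableAt ℝ H w := fun w => (hH.differentiable (by simp)).differentiableAt
  have hH2 : ContDiffAt ℝ 2 H z := (hH.of_le (by norm_cast)).contDiffAt
  have hopen : ∀ᶠ w in 𝓝 z, w ≠ (0 : E3) := isOpen_compl_singleton.mem_nhds hz
  have hev : horizonProfile l H 0 =ᶠ[𝓝 z] fun w =>
      (2 * (‖w‖ ^ 2) ^ a) • gradient H w + ((l : ℝ) * (l - 1) * ((‖w‖ ^ 2) ^ (a - 1) * H w)) • w := by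
    filter_upwards [hopen] with w hw using horizonProfile_eq_closedForm hl hH hhom hharm hw
  rw [curl_eq_curlCLM, hev.fderiv_eq, ← curl_eq_curlCLM]
  have hf1 : DifferentiableAt ℝ (fun w : E3 => 2 * (‖w‖ ^ 2) ^ a) z := (differentiableAt_rpow_normSq hz a).const_mul 2
  have hf2' : DifferentiableAt ℝ (fun w : E3 => (‖w‖ ^ 2) ^ (a - 1) * H w) z :=
    (differentiableAt_rpow_normSq hz (a - 1)).mul (hHd z)
  have hf2 : DifferentiableAt ℝ (fun w : E3 => (l : ℝ) * (l - 1) * ((‖w‖ ^ 2) ^ (a - 1) * H w)) z := hf2'.const_mul _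
  have h1d : DifferentiableAt ℝ (fun w : E3 => (2 * (‖w‖ ^ 2) ^ a) • gradient H w) z :=
    hf1.smul (differentiableAt_gradient hH2)
  have h2d : DifferentiableAt ℝ (fun w : E3 => ((l : ℝ) * (l - 1) * ((‖w‖ ^ 2) ^ (a - 1) * H w)) • w) z :=
    hf2.smul differentiableAt_id
  rw [curl_add h1d h2d, curl_smul_gradient hf1 hH2, curl_smul_self hf2,
    gradient_const_mul' (differentiableAt_rpow_normSq hz a), gradient_rpow_normSq hz a,
    gradient_const_mul' hf2', gradient_mul_apply (differentiableAt_rpow_normSq hz (a - 1)) (hHd z),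
    gradient_rpow_normSq hz (a - 1)]
  simp only [smul_add, smul_smul, Tao2016.cross_add_left, Tao2016.cross_smul_left, Tao2016.cross_self_eq_zero, smul_zero, add_zero]
  rw [cross_swap z (gradient H z), smul_neg, ← neg_smul, ← add_smul]
  congr 1
  rw [ha]
  ring

/-- **The Lamb vector of the horizon profile off the origin**:
`U × Ω = κ l(l+1) q^{2a−1} H ∇H − κ (2 q^{2a−1} G + l²(l−1) q^{2a−2} H²) z`, `G = ‖∇H‖²`
(BAC − CAB with Euler `⟪∇H, z⟫ = lH`). [cite: MajdaBertozziCUP2002, §1.1 (vector identities)] -/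
theorem lamb_horizonProfile_eq (hl : 1 ≤ l) (hH : ContDiff ℝ (⊤ : ℕ∞) H)
    (hhom : ∀ (c : ℝ) (y : E3), H (c • y) = c ^ l * H y) (hharm : ∀ y, Laplacian.laplacian H y = 0)
    {z : E3} (hz : z ≠ 0) :
    cross (horizonProfile l H 0 z) (curl (horizonProfile l H 0) z)
      = ((((l : ℝ) - 1) * (l + 2)) * (l * (l + 1)) * ((‖z‖ ^ 2) ^ (2 * (((1 : ℝ) - l) / 2) - 1) * H z)) • gradient H z
        + (-(((l : ℝ) - 1) * (l + 2)) * (2 * ((‖z‖ ^ 2) ^ (2 * (((1 : ℝ) - l) / 2) - 1) * ‖gradient H z‖ ^ 2)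
            + (l : ℝ) ^ 2 * (l - 1) * ((‖z‖ ^ 2) ^ (2 * (((1 : ℝ) - l) / 2) - 2) * H z ^ 2))) • z := by
  rw [horizonProfile_eq_closedForm hl hH hhom hharm hz, curl_horizonProfile_eq hl hH hhom hharm hz]
  set a : ℝ := ((1 : ℝ) - l) / 2 with ha
  have hq : 0 < ‖z‖ ^ 2 := by positivity
  have hHd : ∀ w, DifferentiableAt ℝ H w := fun w => (hH.differentiable (by simp)).differentiableAt
  have hE : ⟪gradient H z, z⟫ = (l : ℝ) * H z := inner_gradient_self_of_homogeneous_nat (hHd z) hhom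
  have hE' : ⟪z, gradient H z⟫ = (l : ℝ) * H z := by rw [real_inner_comm, hE]
  rw [Tao2016.cross_smul_right, Tao2016.cross_add_left, Tao2016.cross_smul_left, Tao2016.cross_smul_left,
    Tao2016.cross_cross_eq_smul_sub, Tao2016.cross_cross_eq_smul_sub, hE, hE',
    real_inner_self_eq_norm_sq, real_inner_self_eq_norm_sq]
  obtain ⟨h1, h2, h3, -, -, -⟩ := rpow_canon hq a
  rw [h1, h2, h3]
  module

end ClosedForms

end Summit.NavierStokesRegularity.NavierStokesRegularity.Theorems.PoloidalLiouville.HorizonTower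

end
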